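import Summits.NavierStokesRegularity.NavierStokesRegularity.Theses.AxisymmetricExtremality
import Summits.NavierStokesRegularity.NavierStokesRegularity.Theorems.AxisymmetricExtremalityAxisymmetricKatoGlobalStubSeregin2020TypeIINoSwirlCoreCutoff
import HarnessLib

/-!
# Seregin 2020, proof of Thm 2.1, the no-swirl endgame core: the cut-off field `W = χ • V` of
# the `η = ω_θ/ϱ` maximum principle, with two free radii

Helper toward the stub `stub_seregin2020TypeII` of the crux `AxisymmetricKatoGlobal` (= the named
fact `Literature.Analysis.FluidPDE.Seregin2020_axisymmetricSingularPoint_typeII`, G. Seregin,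
Anal. Math. Phys. 10 (2020) Paper 46 = arXiv:2006.04140, Thm 2.1), last paragraph of the
printed proof (arXiv p. 8). The sibling file `…NoSwirlCoreCutoff` builds the globally smooth
axisymmetric swirl-free field `W = χ • V` of the `η`-maximum principle with the rigid cut-off
`suppCutoff c ρ` (`= 1` on `B̄(c, ρ)`, `= 0` off `B(c, 2ρ)`, data smooth on `B(c, 3ρ)`). At a
clean first singular point `(T, c)` of radius `R`, however, the smooth representative is only
available on `]T - R², T[ × B(c, R₊)` for some `R₊` SLIGHTLY larger than `R` (closedness of the
singular set), while the cut-off must equal `1` near `B̄(c, R)`: the three radii must be free.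
This file redoes the construction with the tree's two-radii radial cut-off
`χ = radialCutoff ρ₁ ρ₂ (· - c)` (`= 1` on `B̄(c, ρ₁)`, `= 0` off `B(c, ρ₂)`) for data smooth on
`B(c, ρ₃)`, `0 < ρ₁ < ρ₂ < ρ₃`:

* `radialCutoffField_contDiff`, `radialCutoffField_isAxisymmetric`,
  `radialCutoffField_hasNoSwirl`, `radialCutoffField_local` — global smoothness, axisymmetry
  (`c` on the axis), no swirl, and agreement of all local quantities with those of `V` on
  `B(c, ρ₁)`;
* `unifTime_radialCutoffField` — the uniform-in-`x` time moduli of all `x`-derivatives on an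
  open time set (Leibniz bound `norm_iteratedFDerivWithin_smul_le` and uniform continuity of
  the `D_xʲ V`, `j ≤ k`, on `[τ - δ₀, τ + δ₀] × B̄(c, ρ₂)`, sibling
  `exists_forall_norm_iteratedFDeriv_sub_le`).

## References

* G. Seregin, Anal. Math. Phys. 10 (2020), Paper 46 = arXiv:2006.04140, proof of Thm. 2.1, last
  paragraph (arXiv p. 8). [Seregin2020]
* G. Koch, N. Nadirashvili, G. Seregin, V. Šverák, Acta Math. 203 (2009) 83–105, §5 p. 9.
  [KochNadirashviliSereginSverak2009]
-/

-- the problem directory repeats the summit name (D-0017); core's `dupNamespace` linter fires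
set_option linter.dupNamespace false

noncomputable section

open MeasureTheory Set Function Filter Topology TopologicalSpace Metric
open scoped NNReal ENNReal ContDiff Laplacian

namespace Summit.NavierStokesRegularity.NavierStokesRegularity.Theorems.AxisymmetricKatoGlobal.EulerScaling

open Literature.Analysis.FluidPDE

section Cutoff

variable {V : ℝ → EuclideanSpace ℝ (Fin 3) → EuclideanSpace ℝ (Fin 3)}
  {c : EuclideanSpace ℝ (Fin 3)} {ρ₁ ρ₂ ρ₃ : ℝ}

/-- The two-radii radial cut-off about an axis point is rotation invariant. [folklore] -/
theorem radialCutoff_sub_rotZ (hc : c 0 = 0 ∧ c 1 = 0) (ρ₁ ρ₂ θ : ℝ)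
    (y : EuclideanSpace ℝ (Fin 3)) :
    radialCutoff ρ₁ ρ₂ (rotZ θ y - c) = radialCutoff ρ₁ ρ₂ (y - c) := by
  have h1 : rotZ θ c = c := by
    ext i
    fin_cases i <;> simp [hc.1, hc.2]
  have h2 : rotZ θ y - c = rotZ θ (y - c) := by
    rw [← rotZL_apply, ← rotZL_apply, map_sub, rotZL_apply θ c, h1]
  rw [h2]
  exact radialCutoff_radial _ _ (norm_rotZ θ _)

/-- Off `B̄(c, ρ₂)` the cut-off field vanishes near the point. [folklore] -/
theorem radialCutoffField_eventuallyEq_zero (h₁ : 0 < ρ₁) (h₁₂ : ρ₁ < ρ₂) (τ : ℝ)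
    {y : EuclideanSpace ℝ (Fin 3)} (hy : ρ₂ < dist y c) :
    (fun y => radialCutoff ρ₁ ρ₂ (y - c) • V τ y) =ᶠ[𝓝 y] fun _ => 0 := by
  have hopen : IsOpen {z : EuclideanSpace ℝ (Fin 3) | ρ₂ < dist z c} :=
    isOpen_lt continuous_const (continuous_id.dist continuous_const)
  filter_upwards [hopen.mem_nhds hy] with z hz
  rw [radialCutoff_eq_zero h₁.le h₁₂ (by rw [← dist_eq_norm]; exact le_of_lt hz), zero_smul]

/-- On `B(c, ρ₁)` the cut-off field is the field, near the point. [folklore] -/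
theorem radialCutoffField_eventuallyEq (h₁ : 0 < ρ₁) (h₁₂ : ρ₁ < ρ₂) (τ : ℝ)
    {x : EuclideanSpace ℝ (Fin 3)} (hx : x ∈ ball c ρ₁) :
    (fun y => radialCutoff ρ₁ ρ₂ (y - c) • V τ y) =ᶠ[𝓝 x] V τ := by
  filter_upwards [isOpen_ball.mem_nhds hx] with z hz
  rw [radialCutoff_eq_one h₁.le h₁₂ (by rw [← dist_eq_norm]; exact (mem_ball.1 hz).le), one_smul]

/-- **The cut-off field is globally smooth** when the slices are smooth at the points of
`B(c, ρ₃)`, `ρ₂ < ρ₃`. [folklore] -/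
theorem radialCutoffField_contDiff (h₁ : 0 < ρ₁) (h₁₂ : ρ₁ < ρ₂) (h₂₃ : ρ₂ < ρ₃) {τ : ℝ}
    (hV : ∀ y ∈ ball c ρ₃, ContDiffAt ℝ ∞ (V τ) y) :
    ContDiff ℝ ∞ fun y => radialCutoff ρ₁ ρ₂ (y - c) • V τ y := by
  have hχ : ContDiff ℝ ∞ fun y : EuclideanSpace ℝ (Fin 3) => radialCutoff ρ₁ ρ₂ (y - c) :=
    (radialCutoff_contDiff (E' := EuclideanSpace ℝ (Fin 3)) ρ₁ ρ₂).comp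
      (contDiff_id.sub contDiff_const)
  refine contDiff_iff_contDiffAt.2 fun y => ?_
  by_cases hy : dist y c < ρ₃
  · exact hχ.contDiffAt.smul (hV y (mem_ball.2 hy))
  · have h2 : ρ₂ < dist y c := by linarith [not_lt.1 hy]
    exact (contDiffAt_const (c := (0 : EuclideanSpace ℝ (Fin 3)))).congr_of_eventuallyEq
      (radialCutoffField_eventuallyEq_zero h₁ h₁₂ τ h2)

/-- **The cut-off field is axisymmetric** when the field is axisymmetric at the points of
`B(c, ρ₃)` and `c` is on the axis. [folklore] -/
theorem radialCutoffField_isAxisymmetric (hc : c 0 = 0 ∧ c 1 = 0) (h₁ : 0 < ρ₁) (h₁₂ : ρ₁ < ρ₂)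
    (h₂₃ : ρ₂ < ρ₃) {τ : ℝ}
    (hV : ∀ θ : ℝ, ∀ y ∈ ball c ρ₃, V τ (rotZ θ y) = rotZ θ (V τ y)) :
    IsAxisymmetric fun y => radialCutoff ρ₁ ρ₂ (y - c) • V τ y := by
  intro θ y
  simp only
  rw [radialCutoff_sub_rotZ hc]
  by_cases hy : dist y c < ρ₃
  · rw [hV θ y (mem_ball.2 hy), ← rotZL_apply, ← rotZL_apply, map_smul]
  · have h2 : ρ₂ ≤ ‖y - c‖ := by rw [← dist_eq_norm]; linarith [not_lt.1 hy]
    rw [radialCutoff_eq_zero h₁.le h₁₂ h2, zero_smul, zero_smul, ← rotZL_apply, map_zero]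

/-- **The cut-off field is swirl free** when the field is swirl free at the points of
`B(c, ρ₃)`. [folklore] -/
theorem radialCutoffField_hasNoSwirl (h₁ : 0 < ρ₁) (h₁₂ : ρ₁ < ρ₂) (h₂₃ : ρ₂ < ρ₃) {τ : ℝ}
    (hV : ∀ y ∈ ball c ρ₃, swirl (V τ) y = 0) :
    HasNoSwirl fun y => radialCutoff ρ₁ ρ₂ (y - c) • V τ y := by
  intro y
  have e : swirl (fun y => radialCutoff ρ₁ ρ₂ (y - c) • V τ y) y =
      radialCutoff ρ₁ ρ₂ (y - c) * swirl (V τ) y := by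
    simp only [swirl, PiLp.smul_apply, smul_eq_mul]
    ring
  rw [e]
  by_cases hy : dist y c < ρ₃
  · rw [hV y (mem_ball.2 hy), mul_zero]
  · have h2 : ρ₂ ≤ ‖y - c‖ := by rw [← dist_eq_norm]; linarith [not_lt.1 hy]
    rw [radialCutoff_eq_zero h₁.le h₁₂ h2, zero_mul]

/-- Local quantities of the cut-off field on `B(c, ρ₁)` are those of the field: the value, the
derivative, the curl, the derivative and the Laplacian of the curl, and the derivative of the
`e₁`-component of the curl. [folklore] -/
theorem radialCutoffField_local (h₁ : 0 < ρ₁) (h₁₂ : ρ₁ < ρ₂) (τ : ℝ)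
    {x : EuclideanSpace ℝ (Fin 3)} (hx : x ∈ ball c ρ₁) :
    (fun y => radialCutoff ρ₁ ρ₂ (y - c) • V τ y) x = V τ x ∧
    fderiv ℝ (fun y => radialCutoff ρ₁ ρ₂ (y - c) • V τ y) x = fderiv ℝ (V τ) x ∧
    curl (fun y => radialCutoff ρ₁ ρ₂ (y - c) • V τ y) x = curl (V τ) x ∧
    fderiv ℝ (curl fun y => radialCutoff ρ₁ ρ₂ (y - c) • V τ y) x = fderiv ℝ (curl (V τ)) x ∧
    (Δ (curl fun y => radialCutoff ρ₁ ρ₂ (y - c) • V τ y)) x = (Δ (curl (V τ))) x ∧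
    fderiv ℝ (fun z => curl (fun y => radialCutoff ρ₁ ρ₂ (y - c) • V τ y) z 1) x =
      fderiv ℝ (fun z => curl (V τ) z 1) x := by
  have hev := radialCutoffField_eventuallyEq (V := V) h₁ h₁₂ τ hx
  -- the curls agree near `x`
  have hcurl : curl (fun y => radialCutoff ρ₁ ρ₂ (y - c) • V τ y) =ᶠ[𝓝 x] curl (V τ) := by
    filter_upwards [hev.eventually_nhds] with z hz
    have hz' : (fun y => radialCutoff ρ₁ ρ₂ (y - c) • V τ y) =ᶠ[𝓝 z] V τ := hz
    rw [curl_eq_curlCLM, curl_eq_curlCLM, hz'.fderiv_eq]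
  have hcurl1 : (fun z => curl (fun y => radialCutoff ρ₁ ρ₂ (y - c) • V τ y) z 1) =ᶠ[𝓝 x]
      fun z => curl (V τ) z 1 := by
    filter_upwards [hcurl] with z hz
    rw [hz]
  refine ⟨hev.self_of_nhds, hev.fderiv_eq, hcurl.self_of_nhds, hcurl.fderiv_eq,
    (InnerProductSpace.laplacian_congr_nhds hcurl).self_of_nhds, hcurl1.fderiv_eq⟩

/-! ### Uniform-in-`x` time moduli of the `x`-derivatives of the cut-off field -/

/-- A uniform bound for the derivatives of order `≤ k` of the two-radii cut-off. [folklore] -/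
theorem exists_forall_norm_iteratedFDeriv_radialCutoff_le (c : EuclideanSpace ℝ (Fin 3))
    (h₁ : 0 < ρ₁) (h₁₂ : ρ₁ < ρ₂) (k : ℕ) : ∃ C : ℝ, 0 ≤ C ∧ ∀ i ≤ k, ∀ y,
      ‖iteratedFDeriv ℝ i (fun y : EuclideanSpace ℝ (Fin 3) => radialCutoff ρ₁ ρ₂ (y - c)) y‖ ≤ C := by
  have hχ : ContDiff ℝ ∞ fun y : EuclideanSpace ℝ (Fin 3) => radialCutoff ρ₁ ρ₂ (y - c) :=
    (radialCutoff_contDiff (E' := EuclideanSpace ℝ (Fin 3)) ρ₁ ρ₂).comp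
      (contDiff_id.sub contDiff_const)
  have hχc : HasCompactSupport fun y : EuclideanSpace ℝ (Fin 3) => radialCutoff ρ₁ ρ₂ (y - c) :=
    (hasCompactSupport_radialCutoff (E := EuclideanSpace ℝ (Fin 3)) h₁.le h₁₂).comp_homeomorph
      (Homeomorph.subRight c)
  have hone : ∀ i : ℕ, ∃ C : ℝ, ∀ y,
      ‖iteratedFDeriv ℝ i (fun y : EuclideanSpace ℝ (Fin 3) => radialCutoff ρ₁ ρ₂ (y - c)) y‖ ≤ C :=
    fun i => (hχ.continuous_iteratedFDeriv (by exact_mod_cast le_top)).bounded_above_of_compact_support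
      (hχc.iteratedFDeriv i)
  induction k with
  | zero =>
    obtain ⟨C, hC⟩ := hone 0
    refine ⟨max C 0, le_max_right _ _, fun i hi y => ?_⟩
    obtain rfl : i = 0 := Nat.le_zero.1 hi
    exact (hC y).trans (le_max_left _ _)
  | succ k ih =>
    obtain ⟨C₁, hC₁0, hC₁⟩ := ih
    obtain ⟨C₂, hC₂⟩ := hone (k + 1)
    refine ⟨max C₁ C₂, le_max_of_le_left hC₁0, fun i hi y => ?_⟩
    rcases Nat.of_le_succ hi with hi' | rfl
    · exact (hC₁ i hi' y).trans (le_max_left _ _)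
    · exact (hC₂ y).trans (le_max_right _ _)

/-- **The uniform-in-`x` time moduli of all `x`-derivatives of the two-radii cut-off field**
(hypothesis `hunif` of the maximum principle): on an open time set `I`, if the slices `V τ`,
`τ ∈ I`, are smooth at the points of `B(c, ρ₃)` and all `D_xⁿ V` are jointly continuous on
`I × B(c, ρ₃)`, `0 < ρ₁ < ρ₂ < ρ₃`, then for `W τ = χ • V τ`, `χ = radialCutoff ρ₁ ρ₂ (· - c)`,
every `k`, `τ ∈ I` and `ε > 0` there is `δ > 0` with `‖D_xᵏ W(τ', y) - D_xᵏ W(τ, y)‖ ≤ ε` for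
all `τ' ∈ I`, `|τ' - τ| < δ` and ALL `y`: off `B̄(c, ρ₂)` both terms vanish; on it, the Leibniz
bound and the uniform continuity of `D_xʲ V`, `j ≤ k`, on `[τ - δ₀, τ + δ₀] × B̄(c, ρ₂)`.
[folklore] -/
theorem unifTime_radialCutoffField :
    ∀ (V : ℝ → EuclideanSpace ℝ (Fin 3) → EuclideanSpace ℝ (Fin 3)) (c : EuclideanSpace ℝ (Fin 3))
      (ρ₁ ρ₂ ρ₃ : ℝ) (I : Set ℝ), IsOpen I → 0 < ρ₁ → ρ₁ < ρ₂ → ρ₂ < ρ₃ →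
      (∀ τ ∈ I, ∀ y ∈ ball c ρ₃, ContDiffAt ℝ (⊤ : ℕ∞) (V τ) y) →
      (∀ n : ℕ, ContinuousOn
        (fun w : ℝ × EuclideanSpace ℝ (Fin 3) => iteratedFDeriv ℝ n (V w.1) w.2)
        (I ×ˢ ball c ρ₃)) →
      ∀ k : ℕ, ∀ τ ∈ I, ∀ ε > 0, ∃ δ > 0, ∀ τ' ∈ I, |τ' - τ| < δ → ∀ y,
        ‖iteratedFDeriv ℝ k (fun y => radialCutoff ρ₁ ρ₂ (y - c) • V τ' y) y -
          iteratedFDeriv ℝ k (fun y => radialCutoff ρ₁ ρ₂ (y - c) • V τ y) y‖ ≤ ε := by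
  intro V c ρ₁ ρ₂ ρ₃ I hI h₁ h₁₂ h₂₃ hVs hVc k τ hτ ε hε
  have hU : IsOpen (ball c ρ₃) := isOpen_ball
  have hcast : ∀ m : ℕ, ((m : ℕ∞) : WithTop ℕ∞) ≤ ((⊤ : ℕ∞) : WithTop ℕ∞) := fun m => by
    exact_mod_cast le_top
  have hχ : ContDiff ℝ ∞ fun y : EuclideanSpace ℝ (Fin 3) => radialCutoff ρ₁ ρ₂ (y - c) :=
    (radialCutoff_contDiff (E' := EuclideanSpace ℝ (Fin 3)) ρ₁ ρ₂).comp
      (contDiff_id.sub contDiff_const)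
  -- bounds for the cut-off
  obtain ⟨Cχ, hCχ0, hCχ⟩ := exists_forall_norm_iteratedFDeriv_radialCutoff_le c h₁ h₁₂ k
  -- a compact time window inside `I`
  obtain ⟨δ₀, hδ₀, hwin⟩ : ∃ δ₀ > 0, Icc (τ - δ₀) (τ + δ₀) ⊆ I := by
    obtain ⟨r, hr, hrI⟩ := Metric.isOpen_iff.1 hI τ hτ
    refine ⟨r / 2, half_pos hr, fun s hs => hrI ?_⟩
    rw [mem_ball, Real.dist_eq, abs_lt]
    constructor <;> linarith [hs.1, hs.2]
  set K : Set (ℝ × EuclideanSpace ℝ (Fin 3)) := Icc (τ - δ₀) (τ + δ₀) ×ˢ closedBall c ρ₂ with hK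
  have hKc : IsCompact K := isCompact_Icc.prod (isCompact_closedBall _ _)
  have hKsub : K ⊆ I ×ˢ ball c ρ₃ := prod_mono hwin (closedBall_subset_ball h₂₃)
  -- the modulus of the `D_xʲ V`, `j ≤ k`, on `K`
  have hη : 0 < ε / (2 ^ k * Cχ + 1) := by positivity
  obtain ⟨δ₁, hδ₁, hmod⟩ := exists_forall_norm_iteratedFDeriv_sub_le hKc hKsub hVc k hη
  refine ⟨min δ₀ δ₁, lt_min hδ₀ hδ₁, fun τ' hτ' hlt y => ?_⟩
  have hlt₀ : |τ' - τ| < δ₀ := hlt.trans_le (min_le_left _ _)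
  have hlt₁ : |τ' - τ| < δ₁ := hlt.trans_le (min_le_right _ _)
  by_cases hy : dist y c ≤ ρ₂
  · -- ## on `B̄(c, ρ₂)`: Leibniz
    have hyU : y ∈ ball c ρ₃ := mem_ball.2 (by linarith)
    have hτ'w : τ' ∈ Icc (τ - δ₀) (τ + δ₀) := by
      rw [abs_lt] at hlt₀; exact ⟨by linarith, by linarith⟩
    have hτw : τ ∈ Icc (τ - δ₀) (τ + δ₀) := ⟨by linarith, by linarith⟩
    have ha : ((τ', y) : ℝ × EuclideanSpace ℝ (Fin 3)) ∈ K := ⟨hτ'w, mem_closedBall.2 hy⟩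
    have hb : ((τ, y) : ℝ × EuclideanSpace ℝ (Fin 3)) ∈ K := ⟨hτw, mem_closedBall.2 hy⟩
    have hab : dist ((τ', y) : ℝ × EuclideanSpace ℝ (Fin 3)) (τ, y) < δ₁ := by
      rw [Prod.dist_eq, dist_self, Real.dist_eq]
      exact max_lt hlt₁ (by simpa using hδ₁)
    -- the difference field
    set D : EuclideanSpace ℝ (Fin 3) → EuclideanSpace ℝ (Fin 3) := V τ' - V τ with hD
    have hDs : ContDiffOn ℝ k D (ball c ρ₃) := fun z hz =>
      (((hVs τ' hτ' z hz).sub (hVs τ hτ z hz)).of_le (hcast k)).contDiffWithinAt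
    have hχs : ContDiffOn ℝ k (fun y : EuclideanSpace ℝ (Fin 3) => radialCutoff ρ₁ ρ₂ (y - c))
        (ball c ρ₃) := (hχ.of_le (hcast k)).contDiffOn
    have hdiff : (fun y => radialCutoff ρ₁ ρ₂ (y - c) • V τ' y) -
        (fun y => radialCutoff ρ₁ ρ₂ (y - c) • V τ y) =
        fun y => radialCutoff ρ₁ ρ₂ (y - c) • D y := by
      funext z
      simp only [Pi.sub_apply, hD, smul_sub]
    have hWτ' : ContDiff ℝ ∞ fun y => radialCutoff ρ₁ ρ₂ (y - c) • V τ' y :=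
      radialCutoffField_contDiff h₁ h₁₂ h₂₃ (hVs τ' hτ')
    have hWτ : ContDiff ℝ ∞ fun y => radialCutoff ρ₁ ρ₂ (y - c) • V τ y :=
      radialCutoffField_contDiff h₁ h₁₂ h₂₃ (hVs τ hτ)
    rw [← iteratedFDeriv_sub_apply (hWτ'.of_le (hcast k)).contDiffAt
      (hWτ.of_le (hcast k)).contDiffAt, hdiff, ← iteratedFDerivWithin_of_isOpen k hU hyU]
    have hleib := norm_iteratedFDerivWithin_smul_le (𝕜 := ℝ) hχs hDs hU.uniqueDiffOn hyU
      (n := k) le_rfl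
    refine hleib.trans ?_
    -- each term is at most `C(k, i) Cχ η`
    have hterm : ∀ i ∈ Finset.range (k + 1),
        (k.choose i : ℝ) *
          ‖iteratedFDerivWithin ℝ i (fun y : EuclideanSpace ℝ (Fin 3) => radialCutoff ρ₁ ρ₂ (y - c))
            (ball c ρ₃) y‖ * ‖iteratedFDerivWithin ℝ (k - i) D (ball c ρ₃) y‖ ≤
        (k.choose i : ℝ) * Cχ * (ε / (2 ^ k * Cχ + 1)) := by
      intro i hi
      have hik : i ≤ k := Nat.lt_succ_iff.1 (Finset.mem_range.1 hi)
      rw [iteratedFDerivWithin_of_isOpen i hU hyU, iteratedFDerivWithin_of_isOpen (k - i) hU hyU]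
      have h1 : ‖iteratedFDeriv ℝ (k - i) D y‖ ≤ ε / (2 ^ k * Cχ + 1) := by
        rw [hD, iteratedFDeriv_sub_apply ((hVs τ' hτ' y hyU).of_le (hcast (k - i)))
          ((hVs τ hτ y hyU).of_le (hcast (k - i)))]
        exact hmod (k - i) (Nat.sub_le k i) (τ', y) ha (τ, y) hb hab
      have h2 := hCχ i hik y
      have h3 : (0 : ℝ) ≤ k.choose i := Nat.cast_nonneg _
      exact mul_le_mul (mul_le_mul_of_nonneg_left h2 h3) h1 (norm_nonneg _) (by positivity)
    refine (Finset.sum_le_sum hterm).trans ?_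
    rw [← Finset.sum_mul, ← Finset.sum_mul]
    have hsum : ∑ i ∈ Finset.range (k + 1), (k.choose i : ℝ) = 2 ^ k := by
      rw [← Nat.cast_sum, Nat.sum_range_choose]; norm_num
    rw [hsum]
    have hA : 0 ≤ (2 : ℝ) ^ k * Cχ := mul_nonneg (pow_nonneg zero_le_two k) hCχ0
    calc (2 : ℝ) ^ k * Cχ * (ε / (2 ^ k * Cχ + 1)) = ε * (2 ^ k * Cχ / (2 ^ k * Cχ + 1)) := by ring
      _ ≤ ε * 1 := by
          refine mul_le_mul_of_nonneg_left ?_ hε.le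
          rw [div_le_one (by positivity)]
          linarith
      _ = ε := mul_one ε
  · -- ## off `B̄(c, ρ₂)`: both terms vanish
    have h2 : ρ₂ < dist y c := not_le.1 hy
    have hz : ∀ σ : ℝ,
        iteratedFDeriv ℝ k (fun y => radialCutoff ρ₁ ρ₂ (y - c) • V σ y) y = 0 := fun σ => by
      rw [((radialCutoffField_eventuallyEq_zero (V := V) h₁ h₁₂ σ h2).iteratedFDeriv ℝ k).eq_of_nhds,
        iteratedFDeriv_fun_zero]
      rfl
    rw [hz τ', hz τ, sub_zero, norm_zero]
    exact hε.le

end Cutoff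

end Summit.NavierStokesRegularity.NavierStokesRegularity.Theorems.AxisymmetricKatoGlobal.EulerScaling

end
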